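import Summits.ResolutionOfSingularities.ResolutionOfSingularities.Theorems.EquisingularLiftEquisingularLiftNatResidueHypDefs7
import Literature.AlgebraicGeometry.Deformation.FibreDimensionEqualityDominance
import HarnessLib

/-!
# [OURS · L1 W4.5b · IDEATOR 2 g26] Sketch for card `tower-hilbert-closure` ROUND 15 — crux EL♮(3) (stmt-ResolutionOfSingularities-20148)

Crux-ideate SKETCH (D-0154 KEY custody; `sorry` allowed ONLY inside the two named `stub_*`; nothing here is registered, nothing is a
statement of any manuscript, nothing of [Hironaka2017] is asserted; everything OURS, counted 0, candidates not facts; AI-written — weaker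
than expert review).  Technique of this seat: deformation theory (T¹/T² of the nose curve, Hilbert-scheme local rings, Hensel).
v3 (2026-08-28T20:5xZ): `stub_exists_dvr_point` REPAIRED per crit-3 g6 TRIAGE r47 (B) — binder `[IsAlgClosed (ResidueField O)]` added
(statement false without it: `ℝ⟦t⟧ → ℝ⟦t,y⟧/(y²+t²)`); nothing else changed (v2 = crux commit c4c21f9a9415).

Context.  After the 39th registration (CHILD v45 d73c58dccb65cdf1 / PARENT v47 e6f8e24f11ceb099) the non-isolated n = 3 residue carries
`¬ NoseHypHostedNestBTriplePrime₂ k n H ι` (…NatResidueHypDefs7).  res-type-nose-w4's census §8 (STATUS l.83248/l.83266) names the first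
candidate surviving every registered door: `S_ν(6;10) = V(g₆² + w² B₁₀)`, nose `Z = V(w, g₆)` a rational 10-nodal plane sextic — after the ten
node blow-ups `(Z^tr)² = −4` in `St Π`, so the hosted round is obstructed (`H¹(𝒪_{ℙ¹}(−4)) = k³`), and `𝒩_{Z^tr/F₁} ≅ 𝒪(−4) ⊕ 𝒪(−14)`.

§1 (R15-1, door D-eq «EQUINODAL PLANAR NOSE», `∀O`-uniform, unramified).  `ReachEquinodalPlanarNose` = a STAGE-LEVEL sub-chain move in the
currency of `ReachHostedNoseBTriplePrime` (Defs6:42): the nose `Z ⊆ T₁ ∩ closure E₁` is an irreducible curve in the (regular) host with only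
ORDINARY NODES (node predicate = parameter `IsOrdNodeIn`; candidate `OrdNodeIn` below: local equation in `𝔪² ∖ 𝔪³`, not a square mod `𝔪³`);
the move is offered AT THE INITIAL STAGE inside the hyperplane host `E₀` (certificate `−K_{E₀}·Z = 3e > 0` automatic; a stage-level variant needs
an equisingular certificate clause since point blow-ups on `Z` cost `Σ mᵢ`), and the sub-chain blows up the nodes ITSELF (so that upstairs it may CHOOSE
the node sections of an equinodal lift — the engine's (pt) steps hand
arbitrary sections, and for `S_ν(6;10)` a Zariski-general choice of sections admits NO flat lift of `Z^tr`: `|6H − 2Σ sⱼ|` over `K = Frac O` is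
empty by Alexander–Hirschowitz (ℙ², d = 6, 10 double points: non-exceptional, 28 − 30 < 0)), then the regular strict transform of `Z`, then a
B‴ tail; `E₉ = ∅`.  `NoseHypHostedNestEquinodalBTriplePrime` = blob₂ VERBATIM + initial-stage closure under the equinodal move; pure-logic inclusion
`…_of_hostedNest₂`.  Upstairs supplier (for the text owner / res-type seats, NOT typed here): EQ1 `stub_hensel_smooth_point` (multivariate
Hensel at a point where the Jacobian has full rank, complete local base) + EQ2 (independence of node conditions: for an irreducible nodal
plane curve of degree e with node set N, `h¹(ℙ², 𝓘_N(e)) = 0` — adjoint argument, [Har77 IV Rem 3.11.1; Dedieu 2023 p.162/Thm 3.3 p.165],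
char-free) + EQ3 (an equinodal `O`-family blown up along its node sections has `O`-smooth strict transform with special fibre `Z^tr`).

§2 (R15-2, door D-lift «LIFTED NOSE FIRST», `∃O′`, ramified bases allowed).  By type the K5′/K5ʰ engine is `O`-PARAMETRIC: `O` is chosen only
at `stub_wittRing` (…NatSubchainPointResolutionOff.lean:191) and the body uses `[CommRing O] [IsDomain O] [IsDiscreteValuationRing O] [CharZero O]
[IsAdicComplete (maximalIdeal O) O] [IsAlgClosed (ResidueField O)]` + `π` surjective; `ELNatConclusionO` quantifies `∃ O`.  `NoseLiftDatumOver O π Z`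
= the embedded-lift clause in the currency of `Literature.….Hartshorne2010_thm_22_3` (flat over `Spec O`, regular, `C.comap (Proj.map φ) = 𝓘_Z`);
`ReachLiftedNoseFirst` = INITIAL-STAGE nose move whose unobstructedness disjunct is REPLACED by the lift datum; `NoseHypLiftedNoseFirstBTriplePrime`
= `∃ (O, π)` admissible ∧ blob₂-body closed additionally under that move; inclusion from blob₂ at any admissible `(O, π)` (e.g. `W(k)`).
Downstairs suppliers of the lift datum: ν1 (`H¹(𝒩) = 0`, F-88/Thm 22.3, `O = W(k)`), the class lists `IsLiftableNoseClass₂` (c.i./det/rat),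
and the NEW ramified one EDL («expected-dimension lifts»): `dim_[Z] Hilb = 4d = χ(𝒩)` ⇒ (relative pro-representing hull `O⟦t₁..t_h⟧/J`,
`μ(J) ≤ h¹(𝒩)`: [Hartshorne DT Thm 11.1/11.3 p.100–101] absolute; relative form = Mori/Kollár, NOT held) ⇒ TREE
`ProRep.relPowerSeries_algebraMap_injective_of_fibre_dim_add_spanFinrank_le` ⇒ `ϖ` misses a minimal prime
(`exists_minimalPrime_not_mem_of_fibre_dim_add_spanFinrank_le`, PROVED below) ⇒ DVR point finite over `O` (`stub_exists_dvr_point`, NF2,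
[Mat86 Thm 8.4, Thm 29.4]) ⇒ `O′`-point of the hull ⇒ (effectivity, F-88-type) the lift over the RAMIFIED `O′`.  Customer: Mumford's
(14,24) curves on cubic surfaces ([Hartshorne DT Thm 13.1 p.106–107]: `dim = 56 = 4·14`, `h⁰(𝒩) = 57`), caught by no `W(k)`-supplier.
Residue after D-lift = Hartshorne DT Rem 22.3.1's open question (p.169) restricted to nose curves, ramified bases allowed.
-/

set_option linter.dupNamespace false
noncomputable section
open CategoryTheory CategoryTheory.Limits AlgebraicGeometry TopologicalSpace Topology IsLocalRing
open Literature.AlgebraicGeometry.Resolution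
open AlgebraicGeometry.Scheme.IdealSheafData
open Summit.ResolutionOfSingularities.ResolutionOfSingularities.Cruxes.EquisingularLiftNat.Sections

namespace Summit.ResolutionOfSingularities.ResolutionOfSingularities.Cruxes.EquisingularLiftNatThree.TowerHilbertClosureG26

/-! ## §1  D-eq: the equinodal planar nose (R15-1) -/

/-- Candidate ORDINARY-NODE predicate (downstairs, stalk-level): for every closed immersion `i : Z̃ ⟶ Ẽ` over `G` of the reduced structures,
the kernel of `𝒪_{Ẽ,z} → 𝒪_{Z̃,z}` is generated by one `f ∈ 𝔪² ∖ 𝔪³` which is NOT a square modulo `𝔪³` (over an algebraically closed residue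
field and a regular 2-dimensional `𝒪_{Ẽ,z}`: the initial form is a non-degenerate binary quadratic form = two distinct tangents). [OURS · candidate] -/
def OrdNodeIn (G : Scheme.{0}) (E : Set G) (hE : IsClosed E) (Z : Set G) (hZ : IsClosed Z) (z : ↥(redSub G Z hZ)) : Prop :=
  ∀ (i : redSub G Z hZ ⟶ redSub G E hE), i ≫ redSubι G E hE = redSubι G Z hZ →
    ∃ f : (redSub G E hE).presheaf.stalk (i.base z),
      Ideal.span {f} = RingHom.ker (i.stalkMap z).hom ∧
      f ∈ maximalIdeal ((redSub G E hE).presheaf.stalk (i.base z)) ^ 2 ∧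
      f ∉ maximalIdeal ((redSub G E hE).presheaf.stalk (i.base z)) ^ 3 ∧
      ∀ l : (redSub G E hE).presheaf.stalk (i.base z), l ∈ maximalIdeal _ →
        f - l ^ 2 ∉ maximalIdeal ((redSub G E hE).presheaf.stalk (i.base z)) ^ 3

/-- **`ReachEquinodalPlanarNose`** (door D-eq, STAGE-LEVEL, same currency as `ReachHostedNoseBTriplePrime`): at stage `(F₁, T₁, E₁)` an
IRREDUCIBLE nose curve `Z ⊆ T₁ ∩ closure E₁`, ambient and host regular along `Z̃`, every closed point of `Z̃` regular or an ordinary node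
IN THE HOST (parameter `IsOrdNodeIn`), finitely many non-regular points; the SUB-CHAIN: point blow-ups at non-regular points of the running
strict transform of `Z` (motive `R` over `F₁` carrying `T`, `E`, `W = Z`-transform) until the transform `Z₂` is regular, then the blow-up of
`Z₂`, then a B‴ tail (`TowerPtRegB₄` / `TowerPtRamB₄` / `TowerRoundBTriplePrime`); the host is dropped: `E₉ = ∅`.  NO unobstructedness clause:
the upstairs supplier is the EQUINODAL lift (EQ1–EQ3 of the module docstring), which chooses the node sections itself.
[OURS · named hypothesis fragment, no mathematical content of its own] -/
def ReachEquinodalPlanarNose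
    (IsOrdNodeIn : ∀ (G : Scheme.{0}) (E : Set G) (hE : IsClosed E) (Z : Set G) (hZ : IsClosed Z), ↥(redSub G Z hZ) → Prop)
    (F₁ : Scheme.{0}) (T₁ E₁ : Set F₁) (F₉ : Scheme.{0}) (β : F₉ ⟶ F₁) (T₉ E₉ : Set F₉) : Prop :=
  E₉ = ∅ ∧
  ∃ (Z : Set F₁) (hZ : IsClosed Z),
    Z ⊆ T₁ ∧ ¬ (T₁ ⊆ Z) ∧ Z.Infinite ∧ Z ⊆ closure E₁ ∧ IsPreirreducible Z ∧
    (∀ z : ↥(redSub F₁ Z hZ), IsClosed ({z} : Set ↥(redSub F₁ Z hZ)) → ringKrullDim ((redSub F₁ Z hZ).presheaf.stalk z) = ((1 : ℕ) : WithBot ℕ∞)) ∧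
    (∀ (i : redSub F₁ Z hZ ⟶ redSub F₁ Set.univ isClosed_univ), i ≫ redSubι F₁ Set.univ isClosed_univ = redSubι F₁ Z hZ →
      ∀ z : ↥(redSub F₁ Z hZ), IsRegularLocalRing ((redSub F₁ Set.univ isClosed_univ).presheaf.stalk (i.base z))) ∧
    (∀ (i : redSub F₁ Z hZ ⟶ redSub F₁ (closure E₁) isClosed_closure), i ≫ redSubι F₁ (closure E₁) isClosed_closure = redSubι F₁ Z hZ →
      ∀ z : ↥(redSub F₁ Z hZ), IsRegularLocalRing ((redSub F₁ (closure E₁) isClosed_closure).presheaf.stalk (i.base z))) ∧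
    (∀ e : ↥(redSub F₁ (closure E₁) isClosed_closure), IsClosed ({e} : Set ↥(redSub F₁ (closure E₁) isClosed_closure)) →
      (redSubι F₁ (closure E₁) isClosed_closure e : F₁) ∈ Z →
      ringKrullDim ((redSub F₁ (closure E₁) isClosed_closure).presheaf.stalk e) = ((2 : ℕ) : WithBot ℕ∞)) ∧
    (∀ z : ↥(redSub F₁ Z hZ), IsClosed ({z} : Set ↥(redSub F₁ Z hZ)) →
      IsRegularLocalRing ((redSub F₁ Z hZ).presheaf.stalk z) ∨ IsOrdNodeIn F₁ (closure E₁) isClosed_closure Z hZ z) ∧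
    {z : ↥(redSub F₁ Z hZ) | ¬ IsRegularLocalRing ((redSub F₁ Z hZ).presheaf.stalk z)}.Finite ∧
    ∃ (F₂ : Scheme.{0}) (υ : F₂ ⟶ F₁) (T₂ E₂ Z₂ : Set F₂) (hZ₂ : IsClosed Z₂),
      (∀ R : (∀ G : Scheme.{0}, (G ⟶ F₁) → Set G → Set G → Set G → Prop),
        R F₁ (𝟙 F₁) T₁ (closure E₁) Z →
        (∀ (G G' : Scheme.{0}) (γ : G ⟶ F₁) (T E W : Set G) (hW : IsClosed W) (w : ↥(redSub G W hW)) (υ₁ : G' ⟶ G)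
            (hy : IsClosed ({(redSubι G W hW w : G)} : Set G)),
          R G γ T E W → ¬ IsRegularLocalRing ((redSub G W hW).presheaf.stalk w) →
          IsBlowup υ₁ (vanishingIdeal (⟨{(redSubι G W hW w : G)}, hy⟩ : Closeds G)) →
          R G' (υ₁ ≫ γ) (closure (υ₁ ⁻¹' (T \ {(redSubι G W hW w : G)}))) (closure (υ₁ ⁻¹' (E \ {(redSubι G W hW w : G)})))
            (closure (υ₁ ⁻¹' (W \ {(redSubι G W hW w : G)})))) →
        R F₂ υ T₂ E₂ Z₂) ∧
      (∀ z : ↥(redSub F₂ Z₂ hZ₂), IsRegularLocalRing ((redSub F₂ Z₂ hZ₂).presheaf.stalk z)) ∧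
      ∃ (F₃ : Scheme.{0}) (υ' : F₃ ⟶ F₂), IsBlowup υ' (vanishingIdeal (⟨Z₂, hZ₂⟩ : Closeds F₂)) ∧
        ∃ (γ' : F₉ ⟶ F₃) (E' : Set F₉) (Es' Ns' : List (Set F₉)) (K' : Set F₉),
          (∀ R : (∀ G : Scheme.{0}, (G ⟶ F₃) → Set G → Set G → List (Set G) → List (Set G) → Set G → Prop),
            R F₃ (𝟙 F₃) (closure (υ' ⁻¹' (T₂ \ Z₂))) (υ' ⁻¹' Z₂) [] [] ∅ →
            TowerPtRegB₄ F₃ R → TowerPtRamB₄ F₃ R → TowerRoundBTriplePrime F₂ F₃ υ' Z₂ hZ₂ R →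
            R F₉ γ' T₉ E' Es' Ns' K') ∧
          β = (γ' ≫ υ') ≫ υ

/-- **`NoseHypHostedNestEquinodalBTriplePrime IsOrdNodeIn k n H ι`** (blob₃ᵉ) — `NoseHypHostedNestBTriplePrime₂` (Defs7:32) VERBATIM, the motive being
ADDITIONALLY closed under `ReachEquinodalPlanarNose IsOrdNodeIn` AT THE INITIAL STAGE (host = the hyperplane `E₀`, where the equisingular certificate
`−K_{E₀}·Z = 3e > 0` holds for every nodal plane curve; when `E₀ = ∅` the clause is vacuous).  Rung shape (R-ν4ᵉ): the residue stub's binders with last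
hypothesis this blob ⊢ `ELNatConclusionO k n H ι`; next residue: `¬` this blob.  A stage-level variant needs an equisingular certificate clause
(`−K_{Ẽ}·Z̃ > 0`, or a Čech `DirStepUnobsES`) because point blow-ups ON `Z` lower the certificate by `Σ mᵢ`. [OURS · named hypothesis, no content of its own] -/
def NoseHypHostedNestEquinodalBTriplePrime (IsOrdNodeIn : ∀ (G : AlgebraicGeometry.Scheme.{0}) (E : Set G) (hE : IsClosed E) (Z : Set G) (hZ : IsClosed Z), ↥(redSub G Z hZ) → Prop)
    (k : Type) [Field k] [IsAlgClosed k] (n : ℕ) (H : AlgebraicGeometry.Scheme.{0})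
    (ι : H ⟶ (Literature.AlgebraicGeometry.Motives.projectiveSpace n k).left) : Prop :=
  letI := MvPolynomial.gradedAlgebra (σ := Fin (n + 1)) (R := k)
  ∃ (E₀ : Set (Literature.AlgebraicGeometry.Motives.projectiveSpace n k).left),
    (E₀ = ∅ ∨ ∃ ℓ : MvPolynomial (Fin (n + 1)) k, ℓ.IsHomogeneous 1 ∧ ℓ ≠ 0 ∧
      ¬ (Set.range ι ⊆ {y : (Literature.AlgebraicGeometry.Motives.projectiveSpace n k).left |
        ℓ ∈ (y : ProjectiveSpectrum (MvPolynomial.homogeneousSubmodule (Fin (n + 1)) k)).asHomogeneousIdeal}) ∧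
      E₀ = {y : (Literature.AlgebraicGeometry.Motives.projectiveSpace n k).left |
        ℓ ∈ (y : ProjectiveSpectrum (MvPolynomial.homogeneousSubmodule (Fin (n + 1)) k)).asHomogeneousIdeal}) ∧
    (∃ (F' : AlgebraicGeometry.Scheme.{0}) (ρ' : F' ⟶ (Literature.AlgebraicGeometry.Motives.projectiveSpace n k).left) (T' : Set F'),
      (∀ Q : (∀ F₁ : AlgebraicGeometry.Scheme.{0}, (F₁ ⟶ (Literature.AlgebraicGeometry.Motives.projectiveSpace n k).left) → Set F₁ → Set F₁ → Prop),
        Q (Literature.AlgebraicGeometry.Motives.projectiveSpace n k).left (𝟙 (Literature.AlgebraicGeometry.Motives.projectiveSpace n k).left) (Set.range ι) E₀ →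
        (∀ (F₁ F₂ : AlgebraicGeometry.Scheme.{0}) (ρ : F₁ ⟶ (Literature.AlgebraicGeometry.Motives.projectiveSpace n k).left) (T₁ E₁ : Set F₁)
            (x : ↥((AlgebraicGeometry.Scheme.IdealSheafData.vanishingIdeal (⟨closure T₁, isClosed_closure⟩ : TopologicalSpace.Closeds F₁))).subscheme) (υ : F₂ ⟶ F₁) (hx : IsClosed ({(((AlgebraicGeometry.Scheme.IdealSheafData.vanishingIdeal (⟨closure T₁, isClosed_closure⟩ : TopologicalSpace.Closeds F₁))).subschemeι x : F₁)} : Set F₁)),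
          Q F₁ ρ T₁ E₁ → ¬ IsRegularLocalRing (((AlgebraicGeometry.Scheme.IdealSheafData.vanishingIdeal (⟨closure T₁, isClosed_closure⟩ : TopologicalSpace.Closeds F₁))).subscheme.presheaf.stalk x) →
          IsRegularLocalRing (F₁.presheaf.stalk (((AlgebraicGeometry.Scheme.IdealSheafData.vanishingIdeal (⟨closure T₁, isClosed_closure⟩ : TopologicalSpace.Closeds F₁))).subschemeι x : F₁)) →
          ((((AlgebraicGeometry.Scheme.IdealSheafData.vanishingIdeal (⟨closure T₁, isClosed_closure⟩ : TopologicalSpace.Closeds F₁))).subschemeι x : F₁) ∈ closure E₁ → ∀ e : ↥(redSub F₁ (closure E₁) isClosed_closure), (redSubι F₁ (closure E₁) isClosed_closure e : F₁) = (((AlgebraicGeometry.Scheme.IdealSheafData.vanishingIdeal (⟨closure T₁, isClosed_closure⟩ : TopologicalSpace.Closeds F₁))).subschemeι x : F₁) →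
          IsRegularLocalRing ((redSub F₁ (closure E₁) isClosed_closure).presheaf.stalk e)) → Literature.AlgebraicGeometry.Resolution.IsBlowup υ
            (AlgebraicGeometry.Scheme.IdealSheafData.vanishingIdeal (⟨{(((AlgebraicGeometry.Scheme.IdealSheafData.vanishingIdeal (⟨closure T₁, isClosed_closure⟩ : TopologicalSpace.Closeds F₁))).subschemeι x : F₁)}, hx⟩ : TopologicalSpace.Closeds F₁)) →
          Q F₂ (υ ≫ ρ) (closure (υ ⁻¹' (T₁ \ {(((AlgebraicGeometry.Scheme.IdealSheafData.vanishingIdeal (⟨closure T₁, isClosed_closure⟩ : TopologicalSpace.Closeds F₁))).subschemeι x : F₁)}))) (closure (υ ⁻¹' (E₁ \ {(((AlgebraicGeometry.Scheme.IdealSheafData.vanishingIdeal (⟨closure T₁, isClosed_closure⟩ : TopologicalSpace.Closeds F₁))).subschemeι x : F₁)})))) →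
        -- STAGE-LEVEL HOSTED ROUND at a regular curve `Z` inside the host, unobstructed IN THE HOST (in-host NEST lines and the nose curve alike)
        (∀ (F₁ F₃ : AlgebraicGeometry.Scheme.{0}) (ρ : F₁ ⟶ (Literature.AlgebraicGeometry.Motives.projectiveSpace n k).left) (T₁ E₁ : Set F₁) (Z : Set F₁) (hZ : IsClosed Z) (υ' : F₃ ⟶ F₁),
          Q F₁ ρ T₁ E₁ → Z ⊆ closure E₁ → Z ⊆ T₁ → ¬ T₁ ⊆ Z → (∀ z : ↥(redSub F₁ Z hZ), IsRegularLocalRing ((redSub F₁ Z hZ).presheaf.stalk z)) →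
          (∀ (i : redSub F₁ Z hZ ⟶ redSub F₁ (closure E₁) isClosed_closure), i ≫ redSubι F₁ (closure E₁) isClosed_closure = redSubι F₁ Z hZ →
            ∀ z : ↥(redSub F₁ Z hZ), IsRegularLocalRing ((redSub F₁ (closure E₁) isClosed_closure).presheaf.stalk (i z))) → DirStepUnobs F₁ (closure E₁) isClosed_closure Z hZ →
          (∀ z : ↥(redSub F₁ Z hZ), IsClosed ({z} : Set ↥(redSub F₁ Z hZ)) → ringKrullDim ((redSub F₁ Z hZ).presheaf.stalk z) = ((1 : ℕ) : WithBot ℕ∞)) →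
          Literature.AlgebraicGeometry.Resolution.IsBlowup υ' (AlgebraicGeometry.Scheme.IdealSheafData.vanishingIdeal (⟨Z, hZ⟩ : TopologicalSpace.Closeds F₁)) →
          Q F₃ (υ' ≫ ρ) (closure (υ' ⁻¹' (T₁ \ Z))) (closure (υ' ⁻¹' (closure E₁ \ Z)))) →
        (∀ (F₁ : AlgebraicGeometry.Scheme.{0}) (ρ : F₁ ⟶ (Literature.AlgebraicGeometry.Motives.projectiveSpace n k).left) (T₁ E₁ : Set F₁) (F₉ : AlgebraicGeometry.Scheme.{0}) (β : F₉ ⟶ F₁) (T₉ E₉ : Set F₉),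
          Q F₁ ρ T₁ E₁ → ReachHostedNoseBTriplePrime F₁ T₁ E₁ F₉ β T₉ E₉ → Q F₉ (β ≫ ρ) T₉ E₉) →
        -- INITIAL-STAGE EQUINODAL PLANAR NOSE inside the hyperplane host `E₀` (certificate −K_{E₀}·Z = 3e > 0 automatic): the sub-chain blows up the nodes itself
        (∀ (F₉ : AlgebraicGeometry.Scheme.{0}) (β : F₉ ⟶ (Literature.AlgebraicGeometry.Motives.projectiveSpace n k).left) (T₉ E₉ : Set F₉),
          Q (Literature.AlgebraicGeometry.Motives.projectiveSpace n k).left (𝟙 (Literature.AlgebraicGeometry.Motives.projectiveSpace n k).left) (Set.range ι) E₀ → ReachEquinodalPlanarNose IsOrdNodeIn (Literature.AlgebraicGeometry.Motives.projectiveSpace n k).left (Set.range ι) E₀ F₉ β T₉ E₉ → Q F₉ β T₉ E₉) → ∃ E' : Set F', Q F' ρ' T' E') ∧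
      Literature.AlgebraicGeometry.Resolution.Scheme.IsRegular (AlgebraicGeometry.Scheme.IdealSheafData.vanishingIdeal (⟨closure T', isClosed_closure⟩ : TopologicalSpace.Closeds F')).subscheme)

/-- blob₂ ⇒ blob₃ᵉ (the extra closure hypothesis is simply not used). [OURS · pure logic] -/
theorem noseHypHostedNestEquinodal_of_hostedNest₂
    (IsOrdNodeIn : ∀ (G : Scheme.{0}) (E : Set G) (hE : IsClosed E) (Z : Set G) (hZ : IsClosed Z), ↥(redSub G Z hZ) → Prop)
    (k : Type) [Field k] [IsAlgClosed k] (n : ℕ) (H : AlgebraicGeometry.Scheme.{0})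
    (ι : H ⟶ (Literature.AlgebraicGeometry.Motives.projectiveSpace n k).left) (h : NoseHypHostedNestBTriplePrime₂ k n H ι) :
    NoseHypHostedNestEquinodalBTriplePrime IsOrdNodeIn k n H ι := by
  obtain ⟨E₀, hE₀, F', ρ', T', hQ, hreg⟩ := h
  exact ⟨E₀, hE₀, F', ρ', T', fun Q hQ0 hpt hround hreach _ => hQ Q hQ0 hpt hround hreach, hreg⟩

/-- **EQ1 (multivariate Hensel at a point of full Jacobian rank, complete local base)** — upstairs brick of the equinodal supplier, stated for
the text owner; PROVABLE (standard: Bourbaki AC III §4 no. 5 Cor. 2 / EGA IV 18.5.17); `sorry` = not proved in this sketch. [OURS · stub] -/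
theorem stub_hensel_smooth_point (O : Type) [CommRing O] [IsLocalRing O] [IsAdicComplete (maximalIdeal O) O]
    (m c : ℕ) (f : Fin c → MvPolynomial (Fin m) O) (x₀ : Fin m → O)
    (hfx : ∀ i, MvPolynomial.eval x₀ (f i) ∈ maximalIdeal O)
    (hjac : LinearIndependent (ResidueField O)
      (fun i : Fin c => fun j : Fin m => residue O (MvPolynomial.eval x₀ (MvPolynomial.pderiv j (f i))))) :
    ∃ x : Fin m → O, (∀ j, x j - x₀ j ∈ maximalIdeal O) ∧ ∀ i, MvPolynomial.eval x (f i) = 0 := by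
  sorry

/-! ## §2  D-lift: lifted nose first, `∃O′` (R15-2) -/

/-- **`NoseLiftDatumOver k n O π Z hZ`** — the embedded `O`-lift clause for a closed `Z ⊆ ℙⁿ_k` (reduced structure `𝓘_Z`), in the currency of
`Literature.AlgebraicGeometry.Deformation.Hartshorne2010_thm_22_3`: for the graded base change `φ = MvPolynomial.map π` there is an ideal sheaf `C`
on `ℙⁿ_O` with `C.subscheme` FLAT over `Spec O`, REGULAR, and `C.comap (Proj.map φ) = 𝓘_Z`. [OURS · named clause] -/
def NoseLiftDatumOver (k : Type) [Field k] (n : ℕ) (O : Type) [CommRing O] (π : O →+* k)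
    (Z : Set (Literature.AlgebraicGeometry.Motives.projectiveSpace n k).left) (hZ : IsClosed Z) : Prop :=
  letI := MvPolynomial.gradedAlgebra (σ := Fin (n + 1)) (R := O)
  letI := MvPolynomial.gradedAlgebra (σ := Fin (n + 1)) (R := k)
  ∀ (φ : MvPolynomial.homogeneousSubmodule (Fin (n + 1)) O →+*ᵍ MvPolynomial.homogeneousSubmodule (Fin (n + 1)) k)
    (hφ' : HomogeneousIdeal.irrelevant (MvPolynomial.homogeneousSubmodule (Fin (n + 1)) k) ≤
      (HomogeneousIdeal.irrelevant (MvPolynomial.homogeneousSubmodule (Fin (n + 1)) O)).map φ),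
    (∀ s, φ s = MvPolynomial.map π s) →
    ∃ C : (AlgebraicGeometry.Proj (MvPolynomial.homogeneousSubmodule (Fin (n + 1)) O)).IdealSheafData,
      AlgebraicGeometry.Flat (C.subschemeι ≫ AlgebraicGeometry.Proj.toSpecZero (MvPolynomial.homogeneousSubmodule (Fin (n + 1)) O) ≫
        AlgebraicGeometry.Spec.map (CommRingCat.ofHom (algebraMap O (MvPolynomial.homogeneousSubmodule (Fin (n + 1)) O 0)))) ∧
      Literature.AlgebraicGeometry.Resolution.Scheme.IsRegular C.subscheme ∧
      C.comap (AlgebraicGeometry.Proj.map φ hφ') =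
        AlgebraicGeometry.Scheme.IdealSheafData.vanishingIdeal (⟨Z, hZ⟩ : TopologicalSpace.Closeds (Literature.AlgebraicGeometry.Motives.projectiveSpace n k).left)

/-- **`NoseLiftDatum k n Z hZ`** — the `∃O′` ENVELOPE: some complete DVR `O` of characteristic 0 with algebraically closed residue field and
a surjection `π : O → k` (RAMIFIED bases allowed) carries the lift datum.  Suppliers: ν1 (`O = W(k)`), class lists, EDL (ramified). [OURS] -/
def NoseLiftDatum (k : Type) [Field k] (n : ℕ)
    (Z : Set (Literature.AlgebraicGeometry.Motives.projectiveSpace n k).left) (hZ : IsClosed Z) : Prop :=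
  ∃ (O : Type) (_ : CommRing O) (_ : IsDomain O) (_ : IsDiscreteValuationRing O) (_ : CharZero O)
    (_ : IsAdicComplete (IsLocalRing.maximalIdeal O) O) (_ : IsAlgClosed (IsLocalRing.ResidueField O)) (π : O →+* k),
    Function.Surjective π ∧ NoseLiftDatumOver k n O π Z hZ

/-- **`ReachLiftedNoseFirst k n O π H ι F₉ β T₉ E₉`** (door D-lift, INITIAL STAGE, `O`-parametric): the nose-first move of
`ReachHostedNoseBTriplePrime` at stage 0 (`T₁ = range ι`) with the unobstructedness disjunct REPLACED by the lift datum over the engine's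
own base `(O, π)`; then the blow-up of `Z` and a B‴ tail; `E₉ = ∅`. [OURS · named hypothesis fragment] -/
def ReachLiftedNoseFirst (k : Type) [Field k] [IsAlgClosed k] (n : ℕ) (O : Type) [CommRing O] (π : O →+* k)
    (H : Scheme.{0}) (ι : H ⟶ (Literature.AlgebraicGeometry.Motives.projectiveSpace n k).left)
    (F₉ : Scheme.{0}) (β : F₉ ⟶ (Literature.AlgebraicGeometry.Motives.projectiveSpace n k).left) (T₉ E₉ : Set F₉) : Prop :=
  E₉ = ∅ ∧
  ∃ (Z : Set (Literature.AlgebraicGeometry.Motives.projectiveSpace n k).left) (hZ : IsClosed Z),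
    Z ⊆ Set.range ι ∧ ¬ (Set.range ι ⊆ Z) ∧ Z.Infinite ∧
    (∀ z : ↥(redSub _ Z hZ), IsClosed ({z} : Set ↥(redSub _ Z hZ)) → ringKrullDim ((redSub _ Z hZ).presheaf.stalk z) = ((1 : ℕ) : WithBot ℕ∞)) ∧
    (∀ z : ↥(redSub _ Z hZ), IsRegularLocalRing ((redSub _ Z hZ).presheaf.stalk z)) ∧
    NoseLiftDatumOver k n O π Z hZ ∧
    ∃ (F₃ : Scheme.{0}) (υ' : F₃ ⟶ (Literature.AlgebraicGeometry.Motives.projectiveSpace n k).left),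
      IsBlowup υ' (vanishingIdeal (⟨Z, hZ⟩ : Closeds (Literature.AlgebraicGeometry.Motives.projectiveSpace n k).left)) ∧
      ∃ (γ' : F₉ ⟶ F₃) (E' : Set F₉) (Es' Ns' : List (Set F₉)) (K' : Set F₉),
        (∀ R : (∀ G : Scheme.{0}, (G ⟶ F₃) → Set G → Set G → List (Set G) → List (Set G) → Set G → Prop),
          R F₃ (𝟙 F₃) (closure (υ' ⁻¹' (Set.range ι \ Z))) (υ' ⁻¹' Z) [] [] ∅ →
          TowerPtRegB₄ F₃ R → TowerPtRamB₄ F₃ R →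
          TowerRoundBTriplePrime (Literature.AlgebraicGeometry.Motives.projectiveSpace n k).left F₃ υ' Z hZ R →
          R F₉ γ' T₉ E' Es' Ns' K') ∧
        β = γ' ≫ υ'

/-- **`NoseHypLiftedNoseFirstBTriplePrime k n H ι`** (blob₃ᴸ) — `∃ (O, π)` ADMISSIBLE (the engine's instance list) ∧ the body of
`NoseHypHostedNestBTriplePrime₂` VERBATIM, the motive being ADDITIONALLY closed under `ReachLiftedNoseFirst k n O π H ι` at the initial stage.
Rung shape (R-ν5ᴸ): the residue binders with last hypothesis this blob ⊢ `ELNatConclusionO k n H ι`, by the K5ʰ engine run AT THIS `O`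
(K5ᴼ: `stub_wittRing` replaced by the blob's witness) + one round step taking the lift `C` as INPUT instead of calling (T-k).
[OURS · named hypothesis, no content of its own] -/
def NoseHypLiftedNoseFirstBTriplePrime (k : Type) [Field k] [IsAlgClosed k] (n : ℕ) (H : AlgebraicGeometry.Scheme.{0})
    (ι : H ⟶ (Literature.AlgebraicGeometry.Motives.projectiveSpace n k).left) : Prop :=
  letI := MvPolynomial.gradedAlgebra (σ := Fin (n + 1)) (R := k)
  ∃ (O : Type) (_ : CommRing O) (_ : IsDomain O) (_ : IsDiscreteValuationRing O) (_ : CharZero O)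
    (_ : IsAdicComplete (IsLocalRing.maximalIdeal O) O) (_ : IsAlgClosed (IsLocalRing.ResidueField O)) (π : O →+* k),
    Function.Surjective π ∧
  ∃ (E₀ : Set (Literature.AlgebraicGeometry.Motives.projectiveSpace n k).left),
    (E₀ = ∅ ∨ ∃ ℓ : MvPolynomial (Fin (n + 1)) k, ℓ.IsHomogeneous 1 ∧ ℓ ≠ 0 ∧
      ¬ (Set.range ι ⊆ {y : (Literature.AlgebraicGeometry.Motives.projectiveSpace n k).left |
        ℓ ∈ (y : ProjectiveSpectrum (MvPolynomial.homogeneousSubmodule (Fin (n + 1)) k)).asHomogeneousIdeal}) ∧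
      E₀ = {y : (Literature.AlgebraicGeometry.Motives.projectiveSpace n k).left |
        ℓ ∈ (y : ProjectiveSpectrum (MvPolynomial.homogeneousSubmodule (Fin (n + 1)) k)).asHomogeneousIdeal}) ∧
    (∃ (F' : AlgebraicGeometry.Scheme.{0}) (ρ' : F' ⟶ (Literature.AlgebraicGeometry.Motives.projectiveSpace n k).left) (T' : Set F'),
      (∀ Q : (∀ F₁ : AlgebraicGeometry.Scheme.{0}, (F₁ ⟶ (Literature.AlgebraicGeometry.Motives.projectiveSpace n k).left) → Set F₁ → Set F₁ → Prop),
        Q (Literature.AlgebraicGeometry.Motives.projectiveSpace n k).left (𝟙 (Literature.AlgebraicGeometry.Motives.projectiveSpace n k).left) (Set.range ι) E₀ →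
        (∀ (F₁ F₂ : AlgebraicGeometry.Scheme.{0}) (ρ : F₁ ⟶ (Literature.AlgebraicGeometry.Motives.projectiveSpace n k).left) (T₁ E₁ : Set F₁)
            (x : ↥((AlgebraicGeometry.Scheme.IdealSheafData.vanishingIdeal (⟨closure T₁, isClosed_closure⟩ : TopologicalSpace.Closeds F₁))).subscheme) (υ : F₂ ⟶ F₁) (hx : IsClosed ({(((AlgebraicGeometry.Scheme.IdealSheafData.vanishingIdeal (⟨closure T₁, isClosed_closure⟩ : TopologicalSpace.Closeds F₁))).subschemeι x : F₁)} : Set F₁)),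
          Q F₁ ρ T₁ E₁ → ¬ IsRegularLocalRing (((AlgebraicGeometry.Scheme.IdealSheafData.vanishingIdeal (⟨closure T₁, isClosed_closure⟩ : TopologicalSpace.Closeds F₁))).subscheme.presheaf.stalk x) →
          IsRegularLocalRing (F₁.presheaf.stalk (((AlgebraicGeometry.Scheme.IdealSheafData.vanishingIdeal (⟨closure T₁, isClosed_closure⟩ : TopologicalSpace.Closeds F₁))).subschemeι x : F₁)) →
          ((((AlgebraicGeometry.Scheme.IdealSheafData.vanishingIdeal (⟨closure T₁, isClosed_closure⟩ : TopologicalSpace.Closeds F₁))).subschemeι x : F₁) ∈ closure E₁ → ∀ e : ↥(redSub F₁ (closure E₁) isClosed_closure), (redSubι F₁ (closure E₁) isClosed_closure e : F₁) = (((AlgebraicGeometry.Scheme.IdealSheafData.vanishingIdeal (⟨closure T₁, isClosed_closure⟩ : TopologicalSpace.Closeds F₁))).subschemeι x : F₁) →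
          IsRegularLocalRing ((redSub F₁ (closure E₁) isClosed_closure).presheaf.stalk e)) → Literature.AlgebraicGeometry.Resolution.IsBlowup υ
            (AlgebraicGeometry.Scheme.IdealSheafData.vanishingIdeal (⟨{(((AlgebraicGeometry.Scheme.IdealSheafData.vanishingIdeal (⟨closure T₁, isClosed_closure⟩ : TopologicalSpace.Closeds F₁))).subschemeι x : F₁)}, hx⟩ : TopologicalSpace.Closeds F₁)) →
          Q F₂ (υ ≫ ρ) (closure (υ ⁻¹' (T₁ \ {(((AlgebraicGeometry.Scheme.IdealSheafData.vanishingIdeal (⟨closure T₁, isClosed_closure⟩ : TopologicalSpace.Closeds F₁))).subschemeι x : F₁)}))) (closure (υ ⁻¹' (E₁ \ {(((AlgebraicGeometry.Scheme.IdealSheafData.vanishingIdeal (⟨closure T₁, isClosed_closure⟩ : TopologicalSpace.Closeds F₁))).subschemeι x : F₁)})))) →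
        -- STAGE-LEVEL HOSTED ROUND at a regular curve `Z` inside the host, unobstructed IN THE HOST (in-host NEST lines and the nose curve alike)
        (∀ (F₁ F₃ : AlgebraicGeometry.Scheme.{0}) (ρ : F₁ ⟶ (Literature.AlgebraicGeometry.Motives.projectiveSpace n k).left) (T₁ E₁ : Set F₁) (Z : Set F₁) (hZ : IsClosed Z) (υ' : F₃ ⟶ F₁),
          Q F₁ ρ T₁ E₁ → Z ⊆ closure E₁ → Z ⊆ T₁ → ¬ T₁ ⊆ Z → (∀ z : ↥(redSub F₁ Z hZ), IsRegularLocalRing ((redSub F₁ Z hZ).presheaf.stalk z)) →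
          (∀ (i : redSub F₁ Z hZ ⟶ redSub F₁ (closure E₁) isClosed_closure), i ≫ redSubι F₁ (closure E₁) isClosed_closure = redSubι F₁ Z hZ →
            ∀ z : ↥(redSub F₁ Z hZ), IsRegularLocalRing ((redSub F₁ (closure E₁) isClosed_closure).presheaf.stalk (i z))) → DirStepUnobs F₁ (closure E₁) isClosed_closure Z hZ →
          (∀ z : ↥(redSub F₁ Z hZ), IsClosed ({z} : Set ↥(redSub F₁ Z hZ)) → ringKrullDim ((redSub F₁ Z hZ).presheaf.stalk z) = ((1 : ℕ) : WithBot ℕ∞)) →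
          Literature.AlgebraicGeometry.Resolution.IsBlowup υ' (AlgebraicGeometry.Scheme.IdealSheafData.vanishingIdeal (⟨Z, hZ⟩ : TopologicalSpace.Closeds F₁)) →
          Q F₃ (υ' ≫ ρ) (closure (υ' ⁻¹' (T₁ \ Z))) (closure (υ' ⁻¹' (closure E₁ \ Z)))) →
        (∀ (F₁ : AlgebraicGeometry.Scheme.{0}) (ρ : F₁ ⟶ (Literature.AlgebraicGeometry.Motives.projectiveSpace n k).left) (T₁ E₁ : Set F₁) (F₉ : AlgebraicGeometry.Scheme.{0}) (β : F₉ ⟶ F₁) (T₉ E₉ : Set F₉),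
          Q F₁ ρ T₁ E₁ → ReachHostedNoseBTriplePrime F₁ T₁ E₁ F₉ β T₉ E₉ → Q F₉ (β ≫ ρ) T₉ E₉) →
        -- INITIAL-STAGE LIFTED NOSE: the nose curve `Z ⊆ range ι` comes WITH an embedded `O`-lift (the lift datum), then its blow-up and a B‴ tail
        (∀ (F₉ : AlgebraicGeometry.Scheme.{0}) (β : F₉ ⟶ (Literature.AlgebraicGeometry.Motives.projectiveSpace n k).left) (T₉ E₉ : Set F₉),
          Q (Literature.AlgebraicGeometry.Motives.projectiveSpace n k).left (𝟙 (Literature.AlgebraicGeometry.Motives.projectiveSpace n k).left) (Set.range ι) E₀ → ReachLiftedNoseFirst k n O π H ι F₉ β T₉ E₉ → Q F₉ β T₉ E₉) → ∃ E' : Set F', Q F' ρ' T' E') ∧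
      Literature.AlgebraicGeometry.Resolution.Scheme.IsRegular (AlgebraicGeometry.Scheme.IdealSheafData.vanishingIdeal (⟨closure T', isClosed_closure⟩ : TopologicalSpace.Closeds F')).subscheme)

/-- blob₂ at ANY admissible base `(O, π)` ⇒ blob₃ᴸ (the extra closure hypothesis is simply not used). [OURS · pure logic] -/
theorem noseHypLiftedNoseFirst_of_hostedNest₂ (k : Type) [Field k] [IsAlgClosed k] (n : ℕ) (H : AlgebraicGeometry.Scheme.{0})
    (ι : H ⟶ (Literature.AlgebraicGeometry.Motives.projectiveSpace n k).left)
    (O : Type) [CommRing O] [IsDomain O] [IsDiscreteValuationRing O] [CharZero O] [IsAdicComplete (maximalIdeal O) O]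
    [IsAlgClosed (ResidueField O)] (π : O →+* k) (hπ : Function.Surjective π)
    (h : NoseHypHostedNestBTriplePrime₂ k n H ι) : NoseHypLiftedNoseFirstBTriplePrime k n H ι := by
  obtain ⟨E₀, hE₀, F', ρ', T', hQ, hreg⟩ := h
  exact ⟨O, inferInstance, inferInstance, inferInstance, inferInstance, inferInstance, inferInstance, π, hπ, E₀, hE₀, F', ρ', T',
    fun Q hQ0 hpt hround hreach _ => hQ Q hQ0 hpt hround hreach, hreg⟩

/-! ## §3  EDL, the ramified supplier: the algebra behind «expected dimension ⇒ a DVR point» -/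

/-- **(EDL-1) the uniformiser is not nilpotent on an expected-dimension hull.**  From the TREE's Ran skeleton
(`ProRep.relPowerSeries_algebraMap_injective_of_fibre_dim_add_spanFinrank_le`, [Ran 1993, Cor. 3] / [Mat86, Thm 15.1]): `O` a DVR,
`B = O⟦y₁..y_h⟧/J` with `dim (B/𝔪_O B) + μ(J) ≤ h` ⇒ every `ϖ ≠ 0` of `O` misses some MINIMAL PRIME of `B` (so `B/𝔮` is an `O`-flat
branch of the hull).  Geometric reading: `h = h⁰(𝒩_Z)`, `μ(J) ≤ h¹(𝒩_Z)`, `dim (B/𝔪_O B) = dim_[Z] Hilb ℙ³_k`; hypothesis = «the Hilbert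
scheme has the expected dimension `χ(𝒩_Z) = 4d` at `[Z]`». [OURS · proved, 0 sorry] -/
theorem exists_minimalPrime_not_mem_of_fibre_dim_add_spanFinrank_le (O : Type) [CommRing O] [IsDomain O] [IsDiscreteValuationRing O]
    {h : ℕ} (J : Ideal (MvPowerSeries (Fin h) O)) (hJ : J ≠ ⊤)
    (heq : ringKrullDim ((MvPowerSeries (Fin h) O ⧸ J) ⧸
        (maximalIdeal O).map (algebraMap O (MvPowerSeries (Fin h) O ⧸ J))) + J.spanFinrank ≤ h)
    (ϖ : O) (hϖ : ϖ ≠ 0) :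
    ∃ 𝔮 ∈ minimalPrimes (MvPowerSeries (Fin h) O ⧸ J), algebraMap O (MvPowerSeries (Fin h) O ⧸ J) ϖ ∉ 𝔮 := by
  have hinj := Literature.AlgebraicGeometry.Deformation.ProRep.relPowerSeries_algebraMap_injective_of_fibre_dim_add_spanFinrank_le
    O J hJ heq
  have hnn : ¬ IsNilpotent (algebraMap O (MvPowerSeries (Fin h) O ⧸ J) ϖ) := by
    rintro ⟨m, hm⟩
    rw [← map_pow] at hm
    have h0 : ϖ ^ m = 0 := hinj (by rw [hm, map_zero])
    exact pow_ne_zero m hϖ h0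
  by_contra hall
  apply hnn
  have hmem : algebraMap O (MvPowerSeries (Fin h) O ⧸ J) ϖ ∈ (⊥ : Ideal (MvPowerSeries (Fin h) O ⧸ J)).radical := by
    rw [← Ideal.sInf_minimalPrimes]
    refine Ideal.mem_sInf.mpr (fun {𝔮} h𝔮 => ?_)
    by_contra hn
    exact hall ⟨𝔮, h𝔮, hn⟩
  exact mem_nilradical.mp (by simpa [nilradical] using hmem)

/-- **(EDL-2 = NF2) DVR-POINT LEMMA** — stub for the text owner, PROVABLE: `O` a complete DVR, `B` a complete local Noetherian `O`-algebra
(local structure map, same residue field), `𝔮` a minimal prime of `B` not containing `ϖ` ⇒ a complete DVR `O′` FINITE over `O` with the same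
residue field and a local `O`-algebra map `B → O′` (cut `B/𝔮` by a system of parameters starting with `ϖ` [Mat86 Thm 14.1/8.4], take a
coheight-one prime avoiding `ϖ`, normalise the 1-dimensional complete local domain: [Mat86 §29 / Nagata]).  `O′/O` may RAMIFY.
v3 REPAIR (crit-3 g6 TRIAGE r47 (B), STATUS 2026-08-28T20:43:06Z): WITHOUT `[IsAlgClosed (ResidueField O)]` the statement is FALSE —
witness `O = ℝ⟦t⟧`, `B = ℝ⟦t,y⟧/(y² + t²)` (complete local domain, residue field ℝ), `𝔮 = ⊥`: every `O`-finite DVR point `O′` acquires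
`√-1` in its residue field, so the last conjunct fails.  The instance is already part of the `NoseLiftDatum` envelope (l.195 ff.) and of
K5′'s instance list, so the repair costs nothing downstream; with it the residue field of `O′` (finite over `k = k̄`) is `k`. [OURS · stub] -/
theorem stub_exists_dvr_point (O B : Type) [CommRing O] [IsDomain O] [IsDiscreteValuationRing O] [IsAdicComplete (maximalIdeal O) O]
    [IsAlgClosed (ResidueField O)] [CommRing B] [IsLocalRing B] [IsNoetherianRing B] [IsAdicComplete (maximalIdeal B) B] [Algebra O B]
    (hloc : IsLocalHom (algebraMap O B)) (hres : Function.Surjective (fun x : O => residue B (algebraMap O B x)))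
    (ϖ : O) (hϖ : Irreducible ϖ) (𝔮 : Ideal B) (h𝔮 : 𝔮 ∈ minimalPrimes B) (hϖ𝔮 : algebraMap O B ϖ ∉ 𝔮) :
    ∃ (O' : Type) (_ : CommRing O') (_ : IsDomain O') (_ : IsDiscreteValuationRing O') (_ : IsAdicComplete (maximalIdeal O') O')
      (_ : Algebra O O') (_ : Module.Finite O O') (f : B →ₐ[O] O'),
      IsLocalHom f.toRingHom ∧ RingHom.ker f.toRingHom ≥ 𝔮 ∧ Function.Surjective (fun x : O => residue O' (algebraMap O O' x)) := by
  sorry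

end Summit.ResolutionOfSingularities.ResolutionOfSingularities.Cruxes.EquisingularLiftNatThree.TowerHilbertClosureG26

end
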